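import Literature.IUT.LogThetaLattice.PacketWeights

/-!
# [IUTchIII] Remark 3.1.1 (iv) / Proposition 3.9 (i): the `E`-weighted measure under coordinatewise
# scalings — packet-normalization on GENERAL regions (proof-only companion of `PacketWeights.lean`)

S. Mochizuki, *Inter-universal Teichmüller theory III*, kurims manuscript (May 2020), §3: Remark 3.1.1 (iv)
p. 97 (the `E`-weighted measure `μ_E(S)` of a Borel set `S ⊆ M_V = Π_v M_v`: "the measure, relative to the
[product] measure space structure of `M_{E*V} (≅ M_W)`, of `S_E`"), Remark 3.1.1 (ii)–(iii) pp. 94–96 ("normalized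
so that multiplication by `p_{v_ℚ}` affects log-volumes by addition or subtraction … of the quantity
`log(p_{v_ℚ})`"; "such weighted sums of log-volumes … may be computed for, say, arbitrary Borel sets by applying
the elementary construction discussed in (iv) below"), and Proposition 3.9 (i) p. 115 l. 41–44 ("we assume that
these log-volumes are normalized so that multiplication of an element of '`𝕄(−)`' by `p_v` corresponds to adding
the quantity `−log(p_v) ∈ ℝ`; we shall refer to this normalization as the packet-normalization"), where `𝕄(−)` is
the set of ALL nonempty compact open subsets (p. 115 l. 34) [claim: Mochizuki2012, status: disputed].

The statement file `PacketWeights.lean` (abc-iut-L6-t4) defines `weightedMeasure E M μ S = μ_E(S)` and proves the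
displayed formula for DIRECT PRODUCT regions (`weightedMeasure_log_directProduct`); `PacketLogVolumes.lean` proves
the packet-normalization on direct product regions (`packetLogVolume_packetNormalized`). The Cor. 3.12 crew's
verbatim container (abc-iut-c312-6, `Summit.ABC.IUTFork.Cor312Vol.packetLogvolE := (1/(N_E·D))·log μ_E`) lives on
GENERAL Borel regions. THIS FILE supplies the general-region scaling law behind the packet-normalization
(abc-iut cell, D-0068 (1) sub-DAG row Prop-39.i.r5a of the [IUTchIII] Prop. 3.9 census, abc-iut-w5-d187):

* `weightedMeasureSet_preimage_pi` — `S_E` of a coordinatewise preimage `Φ⁻¹(S)`, `Φ = (φ_v)_v`, is the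
  coordinatewise preimage of `S_E` on `M_W` (by the very definition of `S_E`);
* `measurableSet_weightedMeasureSet` — `S_E` is measurable for measurable `S` (a finite intersection of
  preimages under measurable "gluing" maps);
* `pi_nnreal_smul` — `⊗_i (c_i • ν_i) = (Π_i c_i) • ⊗_i ν_i` for σ-finite `ν_i` (Mathlib `Measure.pi_eq`);
* **`weightedMeasure_preimage_pi`** — if each `φ_v` is measurable and scales `μ_v` by `c_v ∈ ℝ_{≥0}`
  (`(μ_v).map φ_v = c_v • μ_v`, e.g. multiplication by `p_{v_ℚ}^{-1}` on a `p_{v_ℚ}`-adic summand, which scales the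
  Haar measure by `p_{v_ℚ}^{-dim}` on EVERY Borel set), then `μ_E(Φ⁻¹ S) = (Π_v c_v^{#E_{≠v}}) · μ_E(S)` for every
  measurable `S` (Mathlib `Measure.pi_map_pi`);
* **`weightedMeasure_log_preimage_pi`** — hence, in the normalisation of Remark 3.1.1 (iv),
  `(1/N_E)·log μ_E(Φ⁻¹ S) = (1/N_E)·log μ_E(S) + Σ_v (1/N_v)·log c_v` (`N_v = #E_v`, `N_E = Π_v N_v`) for every
  measurable `S` of finite nonzero `E`-weighted measure — the general-region form of the last display of
  Remark 3.1.1 (iv) — and **`weightedMeasure_log_preimage_pi_of_log_eq`**: if `log c_v = −N_v·D_v` then the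
  normalised log-volume shifts by `−Σ_v D_v` (with the Remark 3.1.1 (ii) weights, `Σ_v D_v = D·log p_{v_ℚ}`, so the
  `(1/(N_E·D))`-normalised log-volume of c312-6 shifts by exactly `−log p_{v_ℚ}` on EVERY admissible region:
  the printed packet-normalization of Prop. 3.9 (i) beyond direct product regions).

No definitions; Mathlib measure theory only (product measures). Nothing here bears on the disputed [IUTchIII]
Cor. 3.12 or takes a side; typed ≠ proved elsewhere.
-/

namespace Literature.IUT.LogThetaLattice

open MeasureTheory
open scoped NNReal ENNReal

universe u₁ u₂ u₃

section Scaling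

variable {V : Type u₁} [Fintype V] [DecidableEq V] {E : V → Type u₂} [∀ v, Fintype (E v)]
variable {M : V → Type u₃} [∀ v, MeasurableSpace (M v)]

omit [Fintype V] [DecidableEq V] [∀ v, Fintype (E v)] [∀ v, MeasurableSpace (M v)] in
/-- `S_E` of a coordinatewise preimage is the coordinatewise preimage of `S_E` on `M_W` ([IUTchIII] Rmk. 3.1.1 (iv)
p. 97: `S_E := (Π_{e∈E} S) ∩ M_{E*V}`, read through the identification `M_W ≅ M_{E*V}`). PROVED (definitional).
[claim: Mochizuki2012, status: disputed] (IUTchIII §3 Rmk 3.1.1 (iv), kurims p.97) -/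
theorem weightedMeasureSet_preimage_pi (φ : ∀ v, M v → M v) (S : Set (∀ v, M v)) :
    weightedMeasureSet E M ((fun x : (∀ v, M v) => fun v => φ v (x v)) ⁻¹' S) =
      (fun n : (∀ w : WIndex E, M w.1) => fun w => φ w.1 (n w)) ⁻¹' weightedMeasureSet E M S :=
  Set.ext fun _ => Iff.rfl

omit [Fintype V] [DecidableEq V] [∀ v, Fintype (E v)] in
/-- The "gluing" map `M_W → M_V`, `n ↦ (v ↦ n_{(v, e|_{≠v})})` attached to `e ∈ E` is measurable.
[claim: Mochizuki2012, status: disputed] (IUTchIII §3 Rmk 3.1.1 (iv), kurims p.97) -/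
theorem measurable_unglue (e : ∀ v, E v) :
    Measurable (fun n : (∀ w : WIndex E, M w.1) => fun v => unglue E M n e v) :=
  measurable_pi_lambda _ fun v => measurable_pi_apply (⟨v, restrictNe E v e⟩ : WIndex E)

omit [DecidableEq V] in
/-- `S_E ⊆ M_W` is measurable for measurable `S ⊆ M_V` (a finite intersection, over `e ∈ E`, of preimages of `S`
under the measurable gluing maps). [claim: Mochizuki2012, status: disputed] (IUTchIII §3 Rmk 3.1.1 (iv), kurims p.97) -/
theorem measurableSet_weightedMeasureSet {S : Set (∀ v, M v)} (hS : MeasurableSet S) :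
    MeasurableSet (weightedMeasureSet E M S) := by
  have h : weightedMeasureSet E M S =
      ⋂ e : (∀ v, E v), (fun n : (∀ w : WIndex E, M w.1) => fun v => unglue E M n e v) ⁻¹' S := by
    ext n
    simp only [weightedMeasureSet, Set.mem_setOf_eq, Set.mem_iInter, Set.mem_preimage]
  rw [h]
  exact MeasurableSet.iInter fun e => measurable_unglue e hS

/-- Product of scaled σ-finite measures: `⊗_i (c_i • ν_i) = (Π_i c_i) • ⊗_i ν_i` (`c_i ∈ ℝ_{≥0}`). [folklore] -/
private theorem pi_nnreal_smul {ι : Type*} [Fintype ι] {α : ι → Type*} [∀ i, MeasurableSpace (α i)]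
    (ν : ∀ i, Measure (α i)) [∀ i, SigmaFinite (ν i)] (c : ι → ℝ≥0) :
    Measure.pi (fun i => c i • ν i) = (∏ i, (c i : ℝ≥0∞)) • Measure.pi ν := by
  refine Measure.pi_eq fun s _ => ?_
  rw [Measure.smul_apply, Measure.pi_pi, smul_eq_mul, ← Finset.prod_mul_distrib]
  refine Finset.prod_congr rfl fun i _ => ?_
  rw [Measure.smul_apply, ENNReal.smul_def, smul_eq_mul]

/-- **`μ_E` under coordinatewise scalings** ([IUTchIII] Rmk. 3.1.1 (iv) p. 97 / Prop. 3.9 (i) p. 115, general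
Borel regions): if each `φ_v : M_v → M_v` is measurable and scales `μ_v` by `c_v` on every Borel set
(`(μ_v).map φ_v = c_v • μ_v`), then `μ_E(Φ⁻¹ S) = (Π_v c_v^{#E_{≠v}}) · μ_E(S)` for every measurable `S ⊆ M_V`,
`Φ = (φ_v)_v` coordinatewise. PROVED (product measures: Mathlib `Measure.pi_map_pi`, `Measure.pi_eq`).
[claim: Mochizuki2012, status: disputed] (IUTchIII §3 Rmk 3.1.1 (iv), kurims p.97) -/
theorem weightedMeasure_preimage_pi (μ : ∀ v, Measure (M v)) [∀ v, SigmaFinite (μ v)]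
    (φ : ∀ v, M v → M v) (hφm : ∀ v, Measurable (φ v)) (c : V → ℝ≥0)
    (hφ : ∀ v, (μ v).map (φ v) = c v • μ v) {S : Set (∀ v, M v)} (hS : MeasurableSet S) :
    weightedMeasure E M μ ((fun x : (∀ v, M v) => fun v => φ v (x v)) ⁻¹' S) =
      (∏ v, (c v : ℝ≥0∞) ^ Fintype.card (ERest E v)) * weightedMeasure E M μ S := by
  unfold weightedMeasure
  rw [weightedMeasureSet_preimage_pi]
  have hΨ : Measurable (fun n : (∀ w : WIndex E, M w.1) => fun w => φ w.1 (n w)) :=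
    measurable_pi_lambda _ fun w => (hφm w.1).comp (measurable_pi_apply w)
  rw [← Measure.map_apply hΨ (measurableSet_weightedMeasureSet hS)]
  haveI : ∀ w : WIndex E, SigmaFinite (((fun w : WIndex E => μ w.1) w).map (φ w.1)) := fun w => by
    show SigmaFinite ((μ w.1).map (φ w.1))
    rw [hφ]
    infer_instance
  rw [Measure.pi_map_pi (μ := fun w : WIndex E => μ w.1) (f := fun w : WIndex E => φ w.1)
    (fun w => (hφm w.1).aemeasurable)]
  have hfam : (fun w : WIndex E => (μ w.1).map (φ w.1)) = fun w : WIndex E => c w.1 • μ w.1 :=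
    funext fun w => hφ w.1
  rw [hfam, pi_nnreal_smul (fun w : WIndex E => μ w.1) (fun w : WIndex E => c w.1), Measure.smul_apply,
    smul_eq_mul]
  congr 1
  rw [Fintype.prod_sigma' (fun (v : V) (_ : ERest E v) => (c v : ℝ≥0∞))]
  simp [Finset.prod_const, Finset.card_univ]

/-- **Packet-normalization on GENERAL regions, log form** ([IUTchIII] Rmk. 3.1.1 (iv) last display p. 97, extended
from direct product regions to all Borel regions; Prop. 3.9 (i) p. 115 l. 41–44): in the situation of
`weightedMeasure_preimage_pi` with all `c_v ≠ 0` and `μ_E(S)` finite nonzero,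
`(1/N_E)·log μ_E(Φ⁻¹ S) = (1/N_E)·log μ_E(S) + Σ_v (1/N_v)·log c_v` (`N_v = #E_v`, `N_E = Π_v N_v`).
[claim: Mochizuki2012, status: disputed] (IUTchIII §3 Rmk 3.1.1 (iv), kurims p.97) -/
theorem weightedMeasure_log_preimage_pi [∀ v, Nonempty (E v)] (μ : ∀ v, Measure (M v))
    [∀ v, SigmaFinite (μ v)] (φ : ∀ v, M v → M v) (hφm : ∀ v, Measurable (φ v)) (c : V → ℝ≥0)
    (hc : ∀ v, c v ≠ 0) (hφ : ∀ v, (μ v).map (φ v) = c v • μ v) {S : Set (∀ v, M v)}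
    (hS : MeasurableSet S) (hpos : weightedMeasure E M μ S ≠ 0) (hfin : weightedMeasure E M μ S ≠ ⊤) :
    (1 / ∏ v, (Fintype.card (E v) : ℝ)) *
        Real.log (weightedMeasure E M μ ((fun x : (∀ v, M v) => fun v => φ v (x v)) ⁻¹' S)).toReal =
      (1 / ∏ v, (Fintype.card (E v) : ℝ)) * Real.log (weightedMeasure E M μ S).toReal +
        ∑ v, (1 / (Fintype.card (E v) : ℝ)) * Real.log (c v : ℝ) := by
  rw [weightedMeasure_preimage_pi μ φ hφm c hφ hS, ENNReal.toReal_mul, ENNReal.toReal_prod]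
  have hc' : ∀ v, ((c v : ℝ≥0∞) ^ Fintype.card (ERest E v)).toReal = (c v : ℝ) ^ Fintype.card (ERest E v) :=
    fun v => by rw [ENNReal.toReal_pow, ENNReal.coe_toReal]
  simp_rw [hc']
  have hprod_ne : ∏ v, (c v : ℝ) ^ Fintype.card (ERest E v) ≠ 0 :=
    Finset.prod_ne_zero_iff.mpr fun v _ => pow_ne_zero _ (NNReal.coe_ne_zero.mpr (hc v))
  have hS_ne : (weightedMeasure E M μ S).toReal ≠ 0 := ENNReal.toReal_ne_zero.mpr ⟨hpos, hfin⟩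
  rw [Real.log_mul hprod_ne hS_ne, Real.log_prod]
  · rw [mul_add, add_comm, Finset.mul_sum]
    congr 1
    refine Finset.sum_congr rfl fun v _ => ?_
    rw [Real.log_pow]
    have hN : (Fintype.card (ERest E v) : ℝ) * (Fintype.card (E v) : ℝ)
        = ∏ v', (Fintype.card (E v') : ℝ) := by
      exact_mod_cast card_ERest_mul (E := E) v
    have hEv : (0 : ℝ) < Fintype.card (E v) := by exact_mod_cast Fintype.card_pos
    rw [← hN]
    field_simp
  · intro v _
    exact pow_ne_zero _ (NNReal.coe_ne_zero.mpr (hc v))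

/-- **Packet-normalization on GENERAL regions** ([IUTchIII] Prop. 3.9 (i), p. 115 l. 41–44 "multiplication of an
element of '`𝕄(−)`' by `p_v` corresponds to adding the quantity `−log(p_v)`", with Rmk. 3.1.1 (ii) weights): if the
scaling constants satisfy `log c_v = −N_v · D_v` (for multiplication by `p_{v_ℚ}` on the summand indexed by
`v = {v_α}`: `N_v·D_v = dim_{ℚ_{p}}(⊗_α K_{v_α})·log p = N_v·(Π_α [(F_mod)_{w_α}:ℚ_p])·log p`), then the
`(1/N_E)`-normalised log-volume of EVERY admissible region shifts by `−Σ_v D_v` (`= −D·log p_{v_ℚ}`, whence the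
`(1/(N_E·D))`-normalised log-volume shifts by `−log p_{v_ℚ}`). [claim: Mochizuki2012, status: disputed]
(IUTchIII §3 Prop 3.9 (i), kurims p.115) -/
theorem weightedMeasure_log_preimage_pi_of_log_eq [∀ v, Nonempty (E v)] (μ : ∀ v, Measure (M v))
    [∀ v, SigmaFinite (μ v)] (φ : ∀ v, M v → M v) (hφm : ∀ v, Measurable (φ v)) (c : V → ℝ≥0)
    (hc : ∀ v, c v ≠ 0) (hφ : ∀ v, (μ v).map (φ v) = c v • μ v) (D : V → ℝ)
    (hlog : ∀ v, Real.log (c v : ℝ) = -((Fintype.card (E v) : ℝ) * D v)) {S : Set (∀ v, M v)}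
    (hS : MeasurableSet S) (hpos : weightedMeasure E M μ S ≠ 0) (hfin : weightedMeasure E M μ S ≠ ⊤) :
    (1 / ∏ v, (Fintype.card (E v) : ℝ)) *
        Real.log (weightedMeasure E M μ ((fun x : (∀ v, M v) => fun v => φ v (x v)) ⁻¹' S)).toReal =
      (1 / ∏ v, (Fintype.card (E v) : ℝ)) * Real.log (weightedMeasure E M μ S).toReal - ∑ v, D v := by
  rw [weightedMeasure_log_preimage_pi μ φ hφm c hc hφ hS hpos hfin, sub_eq_add_neg, ← Finset.sum_neg_distrib]
  congr 1
  refine Finset.sum_congr rfl fun v _ => ?_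
  rw [hlog]
  have hEv : (Fintype.card (E v) : ℝ) ≠ 0 := by exact_mod_cast Fintype.card_ne_zero
  field_simp

/-- The IMAGE form for coordinatewise measurable equivalences: `μ_E(Φ(S)) = (Π_v c_v^{#E_{≠v}})·μ_E(S)` when each
`φ_v⁻¹` scales `μ_v` by `c_v` (e.g. `φ_v` = multiplication by `p_{v_ℚ}` on a `p_{v_ℚ}`-adic summand, `φ_v⁻¹` =
multiplication by `p_{v_ℚ}^{-1}`, `c_v = p_{v_ℚ}^{-dim}`). [claim: Mochizuki2012, status: disputed]
(IUTchIII §3 Prop 3.9 (i), kurims p.115) -/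
theorem weightedMeasure_image_piCongrRight (μ : ∀ v, Measure (M v)) [∀ v, SigmaFinite (μ v)]
    (φ : ∀ v, M v ≃ᵐ M v) (c : V → ℝ≥0) (hφ : ∀ v, (μ v).map (φ v).symm = c v • μ v)
    {S : Set (∀ v, M v)} (hS : MeasurableSet S) :
    weightedMeasure E M μ ((MeasurableEquiv.piCongrRight φ) '' S) =
      (∏ v, (c v : ℝ≥0∞) ^ Fintype.card (ERest E v)) * weightedMeasure E M μ S := by
  rw [MeasurableEquiv.image_eq_preimage_symm]
  exact weightedMeasure_preimage_pi μ (fun v => (φ v).symm) (fun v => (φ v).symm.measurable) c hφ hS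

end Scaling

end Literature.IUT.LogThetaLattice
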